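import Mathlib.Analysis.InnerProductSpace.l2Space
import Mathlib.MeasureTheory.Function.L2Space
import Mathlib.MeasureTheory.Measure.SeparableMeasure
import Mathlib.MeasureTheory.Integral.Prod
import Literature.Analysis.OperatorTheory.JointEigenbasis
import HarnessLib

/-!
# Measurability of Hilbert-space-valued maps: Pettis' theorem in a separable Hilbert space,
and strong measurability of the `L²` slices of a jointly measurable function

Analysis/FunctionSpaces support file (measure theory; theorem-only, no definitions, no named
facts). It serves the discharge of `Literature.Analysis.FluidPDE.isMildNSSolutionOn_iff_duhamel_two`
(`FluidPDE/MildSolution.lean`), whose right-hand side is a **Bochner integral in `L²(E; E)`**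
`∫₀ᵗ P e^{ν(t-τ)Δ} div (u ⊗ u)(τ) dτ` of the `L²` classes of the slices of a space–time field that
is only known to be jointly measurable; for that integral to be an honest (non-junk) Bochner
integral one needs the map `τ ↦ [N(τ, ·)] ∈ L²` to be (a.e.) strongly measurable.

* `Literature.Analysis.FunctionSpaces.stronglyMeasurable_of_forall_measurable_inner` (**Pettis'
  measurability theorem, separable Hilbert case**): if `H` is a separable real Hilbert space and
  `x ↦ ⟪h, f x⟫` is measurable for every `h`, then `f` is strongly measurable. Proof: expand in a
  countable Hilbert basis (`exists_hilbertBasis`; orthonormal sets in a separable space are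
  countable, tree lemma `Orthonormal.countable_of_separableSpace`); the partial sums are finite
  sums of measurable scalar functions times constant vectors and converge pointwise
  (`HilbertBasis.hasSum_repr`), so `stronglyMeasurable_of_tendsto` applies. The a.e. version is
  `aestronglyMeasurable_of_forall_aemeasurable_inner`.
* `Literature.Analysis.FunctionSpaces.aestronglyMeasurable_of_ae_eq_slice` (**`L²` slices**): if
  `G : P × X → F` is a.e. strongly measurable for `μ.prod ν` and `N : P → L²(ν; F)` represents the
  slices, `N p = G(p, ·)` a.e. for a.e. `p`, then `N` is a.e. strongly measurable. Proof: by Pettis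
  it suffices that `p ↦ ⟪h, N p⟫ = ∫ ⟪h x, G (p, x)⟫ dν` be a.e. measurable for each `h ∈ L²`,
  which is the measurability half of Fubini (`AEStronglyMeasurable.integral_prod_right'`).

## Mathlib / tree search

Mathlib (this pin) has Hilbert bases (`HilbertBasis`, `exists_hilbertBasis`,
`HilbertBasis.hasSum_repr`, `HilbertBasis.repr_apply_apply`), second countability of `Lp`
(`MeasureTheory.Lp.SecondCountableTopology`, under `Fact (1 ≤ p)`, `Fact (p ≠ ∞)`,
`IsSeparable μ`), limits of strongly measurable maps (`stronglyMeasurable_of_tendsto`,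
`aestronglyMeasurable_of_tendsto_ae`) and the Fubini measurability lemma
`AEStronglyMeasurable.integral_prod_right'`; it has **no Pettis measurability theorem** (weakly
measurable ⇒ strongly measurable; searched `Pettis`, `weakly measurable`,
`of_forall_measurable_inner`) and no statement on the strong measurability of `Lp`-valued slice
maps (searched `toLp.*slice`, `StronglyMeasurable.*curry.*Lp`). The tree has the converse
selection theorem `exists_measurable_uncurry_of_continuousOn_Lp` (`LpJointMeasurable.lean`) and
`Orthonormal.countable_of_separableSpace` (`OperatorTheory/JointEigenbasis.lean`), used here.

## References

* B. J. Pettis, *On integration in vector spaces*, Trans. Amer. Math. Soc. 44 (1938) 277–304,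
  Thm. 1.1 (weak + a.e.-separably valued ⇒ strong measurability).
* J. Diestel, J. J. Uhl, *Vector Measures*, AMS Math. Surveys 15 (1977), Ch. II §1, Thm. 2
  (Pettis measurability theorem).
-/

noncomputable section

open MeasureTheory TopologicalSpace Set Function Filter Topology
open scoped RealInnerProductSpace ENNReal NNReal

namespace Literature.Analysis.FunctionSpaces

/-! ### Pettis' measurability theorem in a separable Hilbert space -/

section Pettis

variable {X : Type*} [MeasurableSpace X]
  {H : Type*} [NormedAddCommGroup H] [InnerProductSpace ℝ H] [CompleteSpace H] [SeparableSpace H]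

/-- A separable Hilbert space has a **countable** Hilbert basis (Mathlib's `exists_hilbertBasis`
plus countability of orthonormal sets in separable spaces). [folklore] -/
theorem exists_countable_hilbertBasis :
    ∃ (w : Set H) (b : HilbertBasis w ℝ H), w.Countable ∧ ⇑b = ((↑) : w → H) := by
  obtain ⟨w, b, hb⟩ := exists_hilbertBasis ℝ H
  refine ⟨w, b, ?_, hb⟩
  have h : Orthonormal ℝ ((↑) : w → H) := hb ▸ b.orthonormal
  exact h.countable_of_separableSpace

/-- **Pettis' measurability theorem (separable Hilbert space).** If `x ↦ ⟪h, f x⟫` is measurable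
for every `h`, then `f` is strongly measurable: the partial sums of the expansion of `f x` in a
countable Hilbert basis are strongly measurable and converge to `f x` for every `x`
(Pettis 1938, Thm. 1.1; Diestel–Uhl, Ch. II §1 Thm. 2). [cite: Pettis1938, Thm. 1.1] -/
theorem stronglyMeasurable_of_forall_measurable_inner {f : X → H}
    (hf : ∀ h : H, Measurable fun x => ⟪h, f x⟫) : StronglyMeasurable f := by
  obtain ⟨w, b, hwc, hb⟩ := exists_countable_hilbertBasis (H := H)
  haveI : Countable w := hwc.to_subtype
  have hF : ∀ s : Finset w,
      StronglyMeasurable fun x => ∑ i ∈ s, ⟪(b i : H), f x⟫ • (b i : H) := fun s =>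
    Finset.stronglyMeasurable_fun_sum s fun i _ => (hf (b i)).stronglyMeasurable.smul_const _
  refine stronglyMeasurable_of_tendsto (atTop : Filter (Finset w)) hF ?_
  rw [tendsto_pi_nhds]
  intro x
  have h := b.hasSum_repr (f x)
  simp_rw [b.repr_apply_apply] at h
  simpa [HasSum] using h

/-- **Pettis' measurability theorem, a.e. version (separable Hilbert space).** If `x ↦ ⟪h, f x⟫`
is a.e. measurable for every `h`, then `f` is a.e. strongly measurable (Pettis 1938, Thm. 1.1;
Diestel–Uhl, Ch. II §1 Thm. 2). [cite: Pettis1938, Thm. 1.1] -/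
theorem aestronglyMeasurable_of_forall_aemeasurable_inner {μ : Measure X} {f : X → H}
    (hf : ∀ h : H, AEMeasurable (fun x => ⟪h, f x⟫) μ) : AEStronglyMeasurable f μ := by
  obtain ⟨w, b, hwc, hb⟩ := exists_countable_hilbertBasis (H := H)
  haveI : Countable w := hwc.to_subtype
  have hF : ∀ s : Finset w,
      AEStronglyMeasurable (fun x => ∑ i ∈ s, ⟪(b i : H), f x⟫ • (b i : H)) μ := fun s =>
    Finset.aestronglyMeasurable_fun_sum s fun i _ =>
      (hf (b i)).aestronglyMeasurable.smul_const _
  refine aestronglyMeasurable_of_tendsto_ae (atTop : Filter (Finset w)) hF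
    (Eventually.of_forall fun x => ?_)
  have h := b.hasSum_repr (f x)
  simp_rw [b.repr_apply_apply] at h
  simpa [HasSum] using h

end Pettis

/-! ### Strong measurability of `L²` slice maps -/

section Slices

variable {P : Type*} [MeasurableSpace P] {μ : Measure P}
  {X : Type*} [MeasurableSpace X] {ν : Measure X} [SFinite ν] [IsSeparable ν]
  {F : Type*} [NormedAddCommGroup F] [InnerProductSpace ℝ F] [CompleteSpace F]
  [SecondCountableTopology F]

/-- **The `L²` slices of a jointly measurable function form an a.e. strongly measurable
`L²`-valued map.** If `G : P × X → F` is a.e. strongly measurable for `μ.prod ν` and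
`N : P → L²(ν; F)` represents its slices, `N p = G (p, ·)` `ν`-a.e. for `μ`-a.e. `p`, then `N` is
a.e. strongly measurable (so that Bochner integrals `∫ N dμ` in `L²` are not junk). Pettis'
theorem reduces this to the a.e. measurability of `p ↦ ⟪h, N p⟫ = ∫ ⟪h x, G (p, x)⟫ dν(x)`,
which is the measurability half of Fubini's theorem (Diestel–Uhl, Ch. II §1 Thm. 2;
Pettis 1938, Thm. 1.1). [cite: Pettis1938, Thm. 1.1] -/
theorem aestronglyMeasurable_of_ae_eq_slice {G : P × X → F}
    (hG : AEStronglyMeasurable G (μ.prod ν)) {N : P → Lp F 2 ν}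
    (hN : ∀ᵐ p ∂μ, ((N p : Lp F 2 ν) : X → F) =ᵐ[ν] fun x => G (p, x)) :
    AEStronglyMeasurable N μ := by
  haveI : Fact ((2 : ℝ≥0∞) ≠ ∞) := ⟨ENNReal.ofNat_ne_top⟩
  haveI : SecondCountableTopology (Lp F 2 ν) := inferInstance
  refine aestronglyMeasurable_of_forall_aemeasurable_inner fun h => ?_
  have h1 : AEStronglyMeasurable (fun q : P × X => ⟪((h : Lp F 2 ν) : X → F) q.2, G q⟫)
      (μ.prod ν) :=
    (Lp.aestronglyMeasurable h).comp_snd.inner hG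
  have h2 : AEStronglyMeasurable (fun p => ∫ x, ⟪((h : Lp F 2 ν) : X → F) x, G (p, x)⟫ ∂ν) μ :=
    h1.integral_prod_right'
  refine h2.aemeasurable.congr ?_
  filter_upwards [hN] with p hp
  rw [L2.inner_def]
  refine integral_congr_ae ?_
  filter_upwards [hp] with x hx
  rw [hx]

end Slices

end Literature.Analysis.FunctionSpaces
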